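import Summits.AtomisticToContinuum.BoseEinsteinCondensation.Theses.BECInsertionVariance
import Summits.AtomisticToContinuum.BoseEinsteinCondensation.Theorems.BECInsertionVarianceGroundStateAccessibleBoundedUniqueness
import HarnessLib

/-!
# `GroundStateAccessible` for locally bounded pair potentials: the verbatim restatement, proved

Helper for item `GroundStateAccessible` (stmt-AtomisticToContinuum-12069) of route `BECInsertionVariance`
(`Summit.AtomisticToContinuum.BoseEinsteinCondensation.Theses.BECInsertionVariance.GroundStateAccessible`).

The item quantifies over EVERY admissible pair profile `v : ℝ → [0, ∞]` (`IsRepulsiveFiniteRange`: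
measurable, finite range; hard cores `⊤` and non-integrable cores allowed). For BOUNDED `v` its content is
fully in tree (`swapMass_groundState_eq_one_of_bounded`: the nonnegative Dirichlet ground state is a.e.
nonzero on the box, so all two-replica mass is accessible). This file records that half in the EXACT shape
of the item — the item's body verbatim, with the single extra hypothesis `∃ C, ∀ r, v r ≤ C` inserted after
`IsRepulsiveFiniteRange v` — so that a restated (bounded) item can be closed by name:

* `groundStateAccessible_bounded` — `∀ v, IsRepulsiveFiniteRange v → (∃ C, ∀ r, v r ≤ C) → ∃ ρ₀ > 0,
  ∀ ρ ∈ (0, ρ₀), ∀ᶠ n, 1/2 ≤ ∫⁻_{q ≠ 0} ofReal p` (with `ρ₀ = 1`; in fact every `ρ > 0` and every `n`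
  work, and the mass is exactly `1`);
* `groundStateAccessible_iff_unbounded_branch` — the item is EQUIVALENT to its own restriction to
  unbounded admissible `v` (the hard-core branch (H) of `groundStateAccessible_of_unbounded`), i.e. the
  bounded half carries no further obligation.
-/

noncomputable section

open MeasureTheory Filter Set
open scoped ENNReal NNReal Topology

namespace Summit.AtomisticToContinuum.BoseEinsteinCondensation.Theorems.BECInsertionVariance

open Literature.MathematicalPhysics.QuantumManyBody.BoseGas
open Summit.AtomisticToContinuum.BoseEinsteinCondensation.Theses.BECInsertionVariance

/-- **`GroundStateAccessible` restricted to bounded pair potentials, in the item's verbatim shape.**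
For every repulsive finite-range `v` that is BOUNDED (`v ≤ C`), with `ρ₀ = 1`: for `0 < ρ < ρ₀` and
(all, hence eventually all) `n`, the accessible swap mass `∫⁻_{q ≠ 0} ofReal p` of the nonnegative
Dirichlet ground state `Ψ₀ = groundState v (n+1) ((n+1)/ρ)^{1/3}` is `≥ 1/2` (it equals `1`:
`swapMass_groundState_eq_one_of_bounded`, Perron–Frobenius positivity of the Feynman–Kac ground state).
[cite: ReedSimonIV1978, §XIII.12 Thm XIII.47] -/
theorem groundStateAccessible_bounded :
    ∀ v : ℝ → ℝ≥0∞, IsRepulsiveFiniteRange v → (∃ C : ℝ≥0, ∀ r, v r ≤ C) →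
      ∃ ρ₀ : ℝ, 0 < ρ₀ ∧ ∀ ρ : ℝ, 0 < ρ → ρ < ρ₀ → ∀ᶠ n : ℕ in Filter.atTop,
        let Ψ₀ : Config (n + 1) → ℝ := groundState v (n + 1) (sideLength ρ (n + 1))
        let p : Config (n + 1) × Config (n + 1) → ℝ := fun Z => Ψ₀ Z.1 ^ 2 * Ψ₀ Z.2 ^ 2
        let q : Config (n + 1) × Config (n + 1) → ℝ := fun Z =>
          Ψ₀ (Function.update Z.1 0 (Z.2 0)) ^ 2 * Ψ₀ (Function.update Z.2 0 (Z.1 0)) ^ 2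
        (1 / 2 : ℝ≥0∞) ≤ ∫⁻ Z in {Z | q Z ≠ 0}, ENNReal.ofReal (p Z) := by
  intro v hv hb
  refine ⟨1, one_pos, fun ρ hρ _ => Eventually.of_forall fun n => ?_⟩
  show (1 / 2 : ℝ≥0∞) ≤ swapMass n (groundState v (n + 1) (sideLength ρ (n + 1)))
  rw [swapMass_groundState_eq_one_of_bounded (sideLength_pos_of_pos hρ (Nat.succ_pos n)) hv.1 hb]
  exact ENNReal.half_le_self

/-- **The item is equivalent to its hard-core branch.** `GroundStateAccessible` holds iff its own body
holds for every UNBOUNDED admissible `v` (hard cores `v = ⊤·𝟙_{[0,a]}`, hard shells, cores that are not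
locally bounded): the bounded half is `groundStateAccessible_bounded`, the converse is specialisation.
This pins the ENTIRE remaining obligation of the item on the unbounded class. [folklore] -/
theorem groundStateAccessible_iff_unbounded_branch :
    GroundStateAccessible ↔
      ∀ v : ℝ → ℝ≥0∞, IsRepulsiveFiniteRange v → (¬ ∃ C : ℝ≥0, ∀ r, v r ≤ C) →
        ∃ ρ₀ : ℝ, 0 < ρ₀ ∧ ∀ ρ : ℝ, 0 < ρ → ρ < ρ₀ → ∀ᶠ n : ℕ in atTop,
          (1 / 2 : ℝ≥0∞) ≤ swapMass n (groundState v (n + 1) (sideLength ρ (n + 1))) := by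
  refine ⟨fun h v hv _ => ?_, groundStateAccessible_of_unbounded⟩
  obtain ⟨ρ₀, hρ₀, hev⟩ := h v hv
  refine ⟨ρ₀, hρ₀, fun ρ hρ hρ' => ?_⟩
  filter_upwards [hev ρ hρ hρ'] with n hn
  exact hn

end Summit.AtomisticToContinuum.BoseEinsteinCondensation.Theorems.BECInsertionVariance

end
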